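/-
Copyright (c) 2026. Released under the Apache-2.0 license, as the surrounding harness tree.
-/
import Literature.Probability.FitznerVanDerHofstad2017.NobleXiOneMemberDevice
import Literature.Probability.FitznerVanDerHofstad2017.NobleRemainderCrudeN1
import HarnessLib

/-!
# [FvdH17] §6.1, proof of Lemma 5.1, case `|a| = |b| = 0`: the member device as a GENUINE-SUM remainder bound

CITATION HEADER (PLACEMENT v2). This module is part of a certified REPRODUCTION of:
R. Fitzner, R. van der Hofstad, *Mean-field behavior for nearest-neighbor percolation in `d > 10`*,
Electron. J. Probab. **22** (2017) no. 43 [FvdH17] (extended version arXiv:1506.07977v2), §6.1 proof of Lemma 5.1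
(Bound-Xi-case-abZero-split, v2 p. 60: "we extract this explicit term … and bound the original bigger event") with
§3.4 (v2 pp. 30–31: `Ξ_R^{(1)} = Ξ^{(1)} − Ξ^{(1)}_α`), §5.4 (p. 56), and of
R. Fitzner, R. van der Hofstad, *Generalized approach to the non-backtracking lace expansion*, Probab. Theory Related
Fields **169** (2017) 1041–1119 [NoBLE17], Assumption 4.3 (4.43) (p. 1087: the genuine-sum remainder row).
Origin: build `lace` (host summit CriticalPhenomena), LEAN TYPING SEAT 1; node N76-XIR1-DEVICE, successor "XIR1-REAL"
of the cell's lemma DAG (the consumer line of `NobleXiOneMemberDevice.tsum_nobleXiT_one_le_offDiag00_add`).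

WHAT THIS FILE DOES (all `d`-generic).  (R1) `tsum_tsub_le_of_tsum_le_tsum_add`: `g ≤ f`, `Σ g < ∞`,
`Σ f ≤ Σ g + K` ⟹ `Σ (f − g) ≤ K` in `[0,∞]`.  (R2) `offDiag00_rhs_le_ofReal`: under entry-wise real majorants
`v_a ≤ ps_a`, `w_b ≤ pe_b`, `Mx_ab ≤ A_ab` (`(a,b) ≠ (0,0)`), `M ≤ a₀₀`, `T ≤ b₄` and `1 ≤ ps₀`, the device right-hand
side `(Σ_{(a,b)≠(0,0)} v_a Mx_ab w_b) + (v₀v₀ − 1)·M + T` is `≤ ofReal ((Σ_{(a,b)≠(0,0)} ps_a A_ab pe_b) + (ps₀² − 1)·a₀₀ + b₄)`;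
`offDiag00_real_eq`: with `pe₀ = ps₀` that real number is `(Σ_{a,b} ps_a A_ab pe_b − A₀₀) + b₄`.  (R3)
`sumLE_xiR_one_of_tsum_le`: for the percolation split `percolationNobleSplit d p hd hp` (`2 ≤ d`, `p < p_c`),
`Σ' Ξ^{(1)} ≤ Σ' Ξ^{(1)}_α + K`, `K ≤ ofReal B`, `Σ' Ξ^{(1)}_α < ∞` ⟹ `SumLE (xiR 1) B`.  (GLUE)
**`perc_sumLE_xiR_one_device`**: `SumLE ((percolationNobleSplit d p hd hp).xiR 1) ((Σ_{(a,b)≠(0,0)} ps_a A_ab pe_b) + (ps₀² − 1)·a₀₀ + b₄)`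
from the majorant binders `vecPS L a ≤ ofReal ps_a`, `vecPE L b ≤ ofReal pe_b`,
`matAbarAvg (unitVecs d) (· = 1) (blockAbar' L) a b ≤ ofReal A_ab` (`(a,b) ≠ (0,0)`), `matAbarIota' L 0 0 ≤ ofReal a₀₀`,
`Σ'_x Σ_ι 𝓣_{1̲,1,2}(e_ι,x,0) ≤ ofReal b₄`, `Σ' Ξ^{(1)}_α ≤ ofReal Bα` (finiteness only) — every binder has a landed or
claimed producer of the cell; no numeral, no dimension, no cited hypothesis; nothing landed is modified.
-/

noncomputable section

namespace Literature.Probability.FitznerVanDerHofstad2017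

open _root_.MeasureTheory Literature.Barriers.CriticalPhenomena Literature.Probability.Percolation
open Literature.Probability.LatticeModels Literature.Probability.FitznerVanDerHofstad2017.NobleBlocks
open Literature.Probability.FitznerVanDerHofstad2017.NobleBlocks.LenIdx
open Literature.Probability.FitznerVanDerHofstad2017.BlockSummation
open scoped BigOperators ENNReal Matrix

variable {d : ℕ}


/-! ## R1. Cancelling a finite minorant sum -/

/-- `g ≤ f` pointwise, `Σ g < ∞`, `Σ f ≤ Σ g + K` ⟹ `Σ (f − g) ≤ K`.
[cite: FitznerVanDerHofstad2017, §3.4 (arXiv:1506.07977v2 p. 31): `Ξ_R^{(1)} = Ξ^{(1)} − Ξ^{(1)}_α ≥ 0`] -/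
theorem tsum_tsub_le_of_tsum_le_tsum_add {α : Type*} {f g : α → ℝ≥0∞} {K : ℝ≥0∞} (hgf : ∀ x, g x ≤ f x)
    (hg : ∑' x, g x ≠ ∞) (h : ∑' x, f x ≤ (∑' x, g x) + K) : ∑' x, (f x - g x) ≤ K := by
  have hsplit : ∑' x, f x = (∑' x, (f x - g x)) + ∑' x, g x := by
    rw [← ENNReal.tsum_add]
    exact tsum_congr fun x => (tsub_add_cancel_of_le (hgf x)).symm
  rw [hsplit, add_comm (∑' x, g x) K] at h
  exact (ENNReal.add_le_add_iff_right hg).1 h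

/-! ## R2. Entry-wise majorisation of the device right-hand side -/

/-- The device right-hand side under entry-wise real majorants (`1 ≤ ps₀`):
`(Σ_{(a,b)≠(0,0)} v_a Mx_ab w_b) + (v₀·v₀ − 1)·M + T ≤ ofReal ((Σ_{(a,b)≠(0,0)} ps_a A_ab pe_b) + (ps₀·ps₀ − 1)·a₀₀ + b₄)`.
[cite: FitznerVanDerHofstad2017, §6.1 proof of Lemma 5.1 (Bound-Xi-case-abZero-split) (arXiv:1506.07977v2 p. 60); §5.4 (p. 56)] -/
theorem offDiag00_rhs_le_ofReal (v w : Fin 3 → ℝ≥0∞) (Mx : Matrix (Fin 3) (Fin 3) ℝ≥0∞) (M T : ℝ≥0∞)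
    (ps pe : Fin 3 → ℝ) (A : Fin 3 → Fin 3 → ℝ) (a00 b4 : ℝ)
    (hps0 : ∀ a, 0 ≤ ps a) (hpe0 : ∀ b, 0 ≤ pe b) (hA0 : ∀ a b, 0 ≤ A a b) (ha00 : 0 ≤ a00) (hb4 : 0 ≤ b4)
    (h1 : 1 ≤ ps 0) (hv : ∀ a, v a ≤ ENNReal.ofReal (ps a)) (hw : ∀ b, w b ≤ ENNReal.ofReal (pe b))
    (hMx : ∀ a b, ¬ (a = 0 ∧ b = 0) → Mx a b ≤ ENNReal.ofReal (A a b)) (hM : M ≤ ENNReal.ofReal a00)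
    (hT : T ≤ ENNReal.ofReal b4) :
    (∑ a : Fin 3, ∑ b : Fin 3, if a = 0 ∧ b = 0 then 0 else v a * Mx a b * w b) + (v 0 * v 0 - 1) * M + T ≤
      ENNReal.ofReal ((∑ a : Fin 3, ∑ b : Fin 3, if a = 0 ∧ b = 0 then 0 else ps a * A a b * pe b) +
        (ps 0 * ps 0 - 1) * a00 + b4) := by
  have hterm : ∀ a b : Fin 3, (if a = 0 ∧ b = 0 then (0 : ℝ≥0∞) else v a * Mx a b * w b) ≤
      ENNReal.ofReal (if a = 0 ∧ b = 0 then 0 else ps a * A a b * pe b) := by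
    intro a b
    by_cases hab : a = 0 ∧ b = 0
    · simp [hab]
    · rw [if_neg hab, if_neg hab, ENNReal.ofReal_mul (mul_nonneg (hps0 a) (hA0 a b)),
        ENNReal.ofReal_mul (hps0 a)]
      exact mul_le_mul' (mul_le_mul' (hv a) (hMx a b hab)) (hw b)
  have hoff0 : ∀ a : Fin 3, 0 ≤ ∑ b : Fin 3, (if a = 0 ∧ b = 0 then (0 : ℝ) else ps a * A a b * pe b) :=
    fun a => Finset.sum_nonneg fun b _ => by
      split_ifs
      · exact le_rfl
      · exact mul_nonneg (mul_nonneg (hps0 a) (hA0 a b)) (hpe0 b)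
  have hoff : (∑ a : Fin 3, ∑ b : Fin 3, if a = 0 ∧ b = 0 then (0 : ℝ≥0∞) else v a * Mx a b * w b) ≤
      ENNReal.ofReal (∑ a : Fin 3, ∑ b : Fin 3, if a = 0 ∧ b = 0 then 0 else ps a * A a b * pe b) := by
    rw [ENNReal.ofReal_sum_of_nonneg fun a _ => hoff0 a]
    refine Finset.sum_le_sum fun a _ => ?_
    rw [ENNReal.ofReal_sum_of_nonneg fun b _ => ?_]
    · exact Finset.sum_le_sum fun b _ => hterm a b
    · split_ifs
      · exact le_rfl
      · exact mul_nonneg (mul_nonneg (hps0 a) (hA0 a b)) (hpe0 b)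
  have hsq : 0 ≤ ps 0 * ps 0 - 1 := by nlinarith
  have hcoef : v 0 * v 0 - 1 ≤ ENNReal.ofReal (ps 0 * ps 0 - 1) := by
    rw [ENNReal.ofReal_sub _ zero_le_one, ENNReal.ofReal_one, ENNReal.ofReal_mul (hps0 0)]
    exact tsub_le_tsub_right (mul_le_mul' (hv 0) (hv 0)) 1
  have hmem : (v 0 * v 0 - 1) * M ≤ ENNReal.ofReal ((ps 0 * ps 0 - 1) * a00) := by
    rw [ENNReal.ofReal_mul hsq]
    exact mul_le_mul' hcoef hM
  have hsum0 : 0 ≤ (∑ a : Fin 3, ∑ b : Fin 3, if a = 0 ∧ b = 0 then (0 : ℝ) else ps a * A a b * pe b) :=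
    Finset.sum_nonneg fun a _ => hoff0 a
  rw [ENNReal.ofReal_add (add_nonneg hsum0 (mul_nonneg hsq ha00)) hb4, ENNReal.ofReal_add hsum0 (mul_nonneg hsq ha00)]
  exact add_le_add (add_le_add hoff hmem) hT

/-- With `pe₀ ≥ ps₀` (numerically `P⃗^{E,0} = P⃗^{S,0}`) the real majorant is the engines'
`(Σ_{a,b} ps_a A_ab pe_b − a₀₀) + b₄` reading of AUTO l.345: the bookkeeping identity.
[cite: FitznerVanDerHofstad2017, §6.1 proof of Lemma 5.1 (arXiv:1506.07977v2 p. 60)] -/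
theorem offDiag00_real_eq (ps pe : Fin 3 → ℝ) (A : Fin 3 → Fin 3 → ℝ) (b4 : ℝ) (h00 : pe 0 = ps 0) :
    (∑ a : Fin 3, ∑ b : Fin 3, if a = 0 ∧ b = 0 then 0 else ps a * A a b * pe b) + (ps 0 * ps 0 - 1) * A 0 0 + b4 =
      ((∑ a : Fin 3, ∑ b : Fin 3, ps a * A a b * pe b) - A 0 0) + b4 := by
  simp only [Fin.sum_univ_three]
  simp [h00]
  ring

/-! ## R3. The genuine-sum packaging for the percolation split -/

/-- **`Σ_x Ξ_R^{(1)}(x) ≤ B` as a genuine sum** for the percolation split of [FvdH17] §3.4, from the member device's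
`[0,∞]` line `Σ' Ξ^{(1)} ≤ Σ' Ξ^{(1)}_α + K` with `K ≤ ofReal B` and `Σ' Ξ^{(1)}_α < ∞` (`2 ≤ d`, `p < p_c`).
[cite: FitznerVanDerHofstad2017, §3.4 (arXiv:1506.07977v2 p. 31); §6.1 proof of Lemma 5.1 (p. 60)]
[cite: FitznerVanDerHofstad2016NoBLE, Assumption 4.3 (4.43) (PTRF 169 (2017) p. 1087)] -/
theorem sumLE_xiR_one_of_tsum_le (hd : 2 ≤ d) {p : unitInterval} (hp : p < criticalProbI d) {K : ℝ≥0∞} {B : ℝ}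
    (hB : 0 ≤ B) (hK : K ≤ ENNReal.ofReal B) (hα : ∑' x, nobleXiA1T d p x ≠ ∞)
    (h : ∑' x, nobleXiT d p 1 x ≤ (∑' x, nobleXiA1T d p x) + K) :
    SumLE ((percolationNobleSplit d p hd hp).xiR 1) B := by
  have hR : ∀ x, (percolationNobleSplit d p hd hp).xiR 1 x = (nobleXiT d p 1 x - nobleXiA1T d p x).toReal := by
    intro x
    show nobleXiN d p 1 x - (nobleXiAT d p 1 x).toReal = _
    rw [nobleXiN_def, ← ENNReal.toReal_sub_of_le (nobleXiAT_le p 1 x) (nobleXiT_ne_top hd hp 1 x)]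
    rfl
  refine sumLE_of_tsum_ofReal_le ((percolationNobleSplit d p hd hp).xiR_nonneg le_rfl) hB ?_
  calc ∑' x, ENNReal.ofReal ((percolationNobleSplit d p hd hp).xiR 1 x)
      = ∑' x, (nobleXiT d p 1 x - nobleXiA1T d p x) := tsum_congr fun x => by
        rw [hR, ENNReal.ofReal_toReal (ne_top_of_le_ne_top (nobleXiT_ne_top hd hp 1 x) tsub_le_self)]
    _ ≤ K := tsum_tsub_le_of_tsum_le_tsum_add (fun x => nobleXiA1T_le p x) hα h
    _ ≤ ENNReal.ofReal B := hK

/-- Finiteness of `Σ' Ξ^{(1)}_α` from its own majorant (the kernel prices the `Ξ^{(1)}_α` line separately). [folklore] -/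
private theorem tsum_nobleXiA1T_ne_top_of_le {p : unitInterval} {Bα : ℝ} (h : ∑' x, nobleXiA1T d p x ≤ ENNReal.ofReal Bα) :
    ∑' x, nobleXiA1T d p x ≠ ∞ :=
  ne_top_of_le_ne_top ENNReal.ofReal_ne_top h

/-- **CONSUMER LINE (glue)**: the genuine-sum remainder bound `Σ_x Ξ_R^{(1)}(x) ≤ (Σ_{(a,b)≠(0,0)} ps_a A_ab pe_b) + (ps₀² − 1)·a₀₀ + b₄`
for the percolation split, from the member device and entry-wise real majorants of `P⃗^S`, `P⃗^E`, the averaged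
off-diagonal entries, `(Ā')₀₀`, the `𝓣_{1̲,1,2}` sum, and a majorant of `Σ Ξ^{(1)}_α` (finiteness only).
[cite: FitznerVanDerHofstad2017, §6.1 proof of Lemma 5.1 (Bound-Xi-case-abZero-split) (arXiv:1506.07977v2 p. 60); §3.4 (p. 31)] -/
theorem perc_sumLE_xiR_one_device (hd : 2 ≤ d) {p : unitInterval} (hp : p < criticalProbI d)
    (ps pe : Fin 3 → ℝ) (A : Fin 3 → Fin 3 → ℝ) (a00 b4 Bα : ℝ)
    (hps0 : ∀ a, 0 ≤ ps a) (hpe0 : ∀ b, 0 ≤ pe b) (hA0 : ∀ a b, 0 ≤ A a b) (ha00 : 0 ≤ a00) (hb4 : 0 ≤ b4)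
    (hv : ∀ a, vecPS (Letters.perc d p) a ≤ ENNReal.ofReal (ps a))
    (hw : ∀ b, vecPE (Letters.perc d p) b ≤ ENNReal.ofReal (pe b))
    (hMx : ∀ a b, ¬ (a = 0 ∧ b = 0) →
      matAbarAvg (unitVecs d) (fun a : Fin 3 => decide (a = 1)) (blockAbar' (Letters.perc d p)) a b ≤
        ENNReal.ofReal (A a b))
    (hM : matAbarIota' (Letters.perc d p) 0 0 ≤ ENNReal.ofReal a00)
    (hT : ∑' x, ∑ ι : Fin d × Bool, (Letters.perc d p).T (eq 1) (ge 1) (ge 2) (stepVec ι) x 0 ≤ ENNReal.ofReal b4)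
    (hα : ∑' x, nobleXiA1T d p x ≤ ENNReal.ofReal Bα) :
    SumLE ((percolationNobleSplit d p hd hp).xiR 1)
      ((∑ a : Fin 3, ∑ b : Fin 3, if a = 0 ∧ b = 0 then 0 else ps a * A a b * pe b) + (ps 0 * ps 0 - 1) * a00 + b4) := by
  have h1 : 1 ≤ ps 0 := ENNReal.one_le_ofReal.1 ((one_le_vecPS_zero (Letters.perc d p)).trans (hv 0))
  have hMt : matAbarIota' (Letters.perc d p) 0 0 ≠ ⊤ := ne_top_of_le_ne_top ENNReal.ofReal_ne_top hM
  have hsq : 0 ≤ ps 0 * ps 0 - 1 := by nlinarith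
  have hsum0 : 0 ≤ (∑ a : Fin 3, ∑ b : Fin 3, if a = 0 ∧ b = 0 then (0 : ℝ) else ps a * A a b * pe b) :=
    Finset.sum_nonneg fun a _ => Finset.sum_nonneg fun b _ => by
      split_ifs
      · exact le_rfl
      · exact mul_nonneg (mul_nonneg (hps0 a) (hA0 a b)) (hpe0 b)
  have hB : 0 ≤ (∑ a : Fin 3, ∑ b : Fin 3, if a = 0 ∧ b = 0 then (0 : ℝ) else ps a * A a b * pe b) +
      (ps 0 * ps 0 - 1) * a00 + b4 := add_nonneg (add_nonneg hsum0 (mul_nonneg hsq ha00)) hb4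
  have hdev := tsum_nobleXiT_one_le_offDiag00_add (d := d) p hMt
  rw [add_assoc] at hdev
  exact sumLE_xiR_one_of_tsum_le hd hp hB
    (offDiag00_rhs_le_ofReal _ _ _ _ _ ps pe A a00 b4 hps0 hpe0 hA0 ha00 hb4 h1 hv hw hMx hM hT)
    (tsum_nobleXiA1T_ne_top_of_le hα) hdev


end Literature.Probability.FitznerVanDerHofstad2017

end
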